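import Literature.Computability.Complexity.LadnerArgument
import Literature.Computability.Complexity.ClockedUniversalAcceptanceProofs
import Literature.Computability.Complexity.PlumbingBricks
import Literature.Computability.Complexity.ReductionsProofs
import HarnessLib

/-!
# Ladner's theorem: the effective presentation of `P` by clocked universal acceptance

Second layer of the discharge of `Literature.Computability.Complexity.ladner` (`StructuralPH.lean`):
the hypothesis `Ladner.IsPresentationOfP` of `LadnerArgument.lean` — an effective presentation of
`P` by total machines (Homer–Selman 2011, Def. 6.1 and Thm. 6.3: "P and NP are effectively
presentable"; "simply attach polynomial clocks") — is supplied from clocked universal acceptance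
testing in polynomial time (`clockedUniversalAcceptance_holds`, Arora–Barak 2009, Thm. 1.9 with
§1.4.1): with `U ∈ P` the bounded acceptance language, code `c = ⟨e, 1ᵏ⟩` presents

  `Ladner.stdLp c = {z | ⟨e, ⟨z, 1^{(|z|+2)^k}⟩⟩ ∈ U}`,

the language accepted by machine `e` under the clock `(n+2)ᵏ` (budget measured in steps of the
universal machine). Each `stdLp c` is in `P` (an `FP` preimage of `U`), and a language decided by
`M` in time `p(n)` is `stdLp ⟨e_M, 1ᵏ⟩` as soon as `(n+2)ᵏ` dominates the overhead polynomial of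
`e_M` at `p(n)` (completeness of `U` for members, soundness of `U` and uniqueness of the output
of a deterministic machine for non-members).

Main result: `Ladner.isPresentationOfP_stdLp : IsPresentationOfP stdLp`; also the uniform form
`Ladner.stdAcc` / `Ladner.mem_stdLp_iff` used by the diagonalizer.

## References

* S. Homer, A. L. Selman, *Computability and Complexity Theory*, 2nd ed., Springer 2011,
  Def. 6.1, Thm. 6.3 (p. 117). doi:10.1007/978-1-4614-0682-2
* S. Arora, B. Barak, *Computational Complexity: A Modern Approach*, CUP 2009, Thm. 1.9, §1.4.1.
* R. E. Ladner, *On the structure of polynomial time reducibility*, J. ACM 22 (1975) 155–171, §3.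
-/

noncomputable section

namespace Literature.Computability.Complexity

open _root_.Computability Polynomial Turing

namespace Ladner

/-! ### Arithmetic: every polynomial is dominated by a power of `n + 2` -/

/-- Every `ℕ`-polynomial is dominated by `(n + 2)ᵏ` for some `k` (the clocks `(n+2)ᵏ` are
cofinal among polynomial time bounds). [folklore] -/
theorem exists_eval_le_pow_add_two (R : Polynomial ℕ) : ∃ k : ℕ, ∀ n : ℕ, R.eval n ≤ (n + 2) ^ k := by
  obtain ⟨C, K, h⟩ := exists_eval_le_mul_pow_add R
  refine ⟨C + 1 + K, fun n => (h n).trans ?_⟩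
  have h1 : n ^ K ≤ (n + 2) ^ K := Nat.pow_le_pow_left (by omega) K
  have h2 : 1 ≤ (n + 2) ^ K := Nat.one_le_pow _ _ (by omega)
  have h3 : C < 2 ^ C := Nat.lt_two_pow_self
  have h4 : 2 ^ (C + 1) ≤ (n + 2) ^ (C + 1) := Nat.pow_le_pow_left (by omega) _
  calc C * n ^ K + C ≤ 2 * C * (n + 2) ^ K := by nlinarith
    _ ≤ 2 ^ (C + 1) * (n + 2) ^ K := by
        refine Nat.mul_le_mul_right _ ?_
        rw [pow_succ]
        omega
    _ ≤ (n + 2) ^ (C + 1) * (n + 2) ^ K := Nat.mul_le_mul_right _ h4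
    _ = (n + 2) ^ (C + 1 + K) := (pow_add _ _ _).symm

/-! ### The bounded acceptance language and the clocked instances -/

/-- **The bounded acceptance language** `U ∈ P` of clocked universal acceptance testing
(`clockedUniversalAcceptance_holds`), chosen once. [cite: AroraBarakCC2009, Thm. 1.9 and §1.4.1] -/
def stdAcc : Language Bool :=
  Classical.choose clockedUniversalAcceptance_holds

/-- `stdAcc ∈ P`. [cite: AroraBarakCC2009, Thm. 1.9 and §1.4.1] -/
theorem stdAcc_mem_P : stdAcc ∈ Classes.P :=
  (Classical.choose_spec clockedUniversalAcceptance_holds).1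

/-- Completeness and soundness of `stdAcc`: every machine `M` has a code `e` and an overhead
polynomial `p` such that `⟨e, ⟨w, 1ᴺ⟩⟩ ∈ stdAcc` whenever `M` accepts `w` within `t` steps and
`N ≥ p t`, and only if `M` accepts `w`. [cite: AroraBarakCC2009, Thm. 1.9 and §1.4.1] -/
theorem stdAcc_spec (M : TM2ComputableAux Bool Bool) : ∃ (e : List Bool) (p : Polynomial ℕ),
    (∀ (w : List Bool) (t N : ℕ), M.OutputsWithin w [true] t → p.eval t ≤ N →
        boolPair e (boolPair w (List.replicate N true)) ∈ stdAcc) ∧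
    (∀ (w : List Bool) (N : ℕ), boolPair e (boolPair w (List.replicate N true)) ∈ stdAcc →
        ∃ t : ℕ, M.OutputsWithin w [true] t) :=
  (Classical.choose_spec clockedUniversalAcceptance_holds).2 M

/-- **The clocked instance of code `c = ⟨e, u⟩` at `z`**: `⟨e, ⟨z, 1^{(|z|+2)^{|u|}}⟩⟩` (the clock
exponent is the length of the second component of the code), as an `FP` string function of `z`.
[cite: HomerSelman2011, Thm. 6.3 (proof: "attach polynomial clocks")] -/
def accInst (c : List Bool) : List Bool → List Bool :=
  fanoutFn (fun _ => (boolUnpair c).1)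
    (fanoutFn id (Plumb.polyFn ((X + C 2) ^ (boolUnpair c).2.length)))

/-- The clocked instance, explicitly. [folklore] -/
theorem accInst_apply (c z : List Bool) :
    accInst c z = boolPair (boolUnpair c).1
      (boolPair z (List.replicate ((z.length + 2) ^ (boolUnpair c).2.length) true)) := by
  simp [accInst]

/-- The clocked instance of the code `⟨e, 1ᵏ⟩`. [folklore] -/
theorem accInst_boolPair (e : List Bool) (k : ℕ) (z : List Bool) :
    accInst (boolPair e (List.replicate k true)) z =
      boolPair e (boolPair z (List.replicate ((z.length + 2) ^ k) true)) := by
  rw [accInst_apply, boolUnpair_boolPair, List.length_replicate]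

/-- `accInst c ∈ FP`. [folklore] -/
theorem accInst_mem_FP (c : List Bool) : accInst c ∈ FP :=
  fanoutFn_mem_FP (const_mem_FP _) (fanoutFn_mem_FP OracleCompose.id_mem_FP (Plumb.polyFn_mem_FP _))

/-! ### The presentation -/

/-- **The standard presentation of `P`**: `stdLp c = {z | accInst c z ∈ stdAcc}`, the language
accepted by the machine coded in `c` under the clock coded in `c`.
[cite: HomerSelman2011, Thm. 6.3] -/
def stdLp (c : List Bool) : Language Bool :=
  accInst c ⁻¹' stdAcc

/-- Membership in a presented language (definitional). [folklore] -/
theorem mem_stdLp_iff {c z : List Bool} : z ∈ stdLp c ↔ accInst c z ∈ stdAcc :=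
  Iff.rfl

/-- **Every presented language is in `P`** (an `FP` preimage of `stdAcc ∈ P`).
[cite: HomerSelman2011, Thm. 6.3] -/
theorem stdLp_mem_P (c : List Bool) : stdLp c ∈ Classes.P :=
  preimage_mem_P stdAcc_mem_P (accInst_mem_FP c)

/-- A deterministic machine has at most one output word on a given input (the `OutputsWithin`
form of `TM2Std.outputs_unique`; twin of `AvM.outputsWithin_unique`,
`ZPPExpected.outputsWithin_unique`, kept local to keep the import closure small). [folklore] -/
private theorem outputsWithin_unique {Γ₀ Γ₁ : Type} (M : TM2ComputableAux Γ₀ Γ₁) {l : List Γ₀}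
    {l₁ l₂ : List Γ₁} {m₁ m₂ : ℕ} (h₁ : M.OutputsWithin l l₁ m₁) (h₂ : M.OutputsWithin l l₂ m₂) :
    l₁ = l₂ :=
  List.map_injective_iff.2 M.outputAlphabet.symm.injective (TM2Std.outputs_unique M.tm h₁ h₂)

/-- **Every language of `P` is presented.** For `L` decided by `M` in time `p(n)`, with code `e`
and overhead polynomial `p_M`, and `k` such that `p_M (p n) ≤ (n+2)ᵏ`: `stdLp ⟨e, 1ᵏ⟩ = L`
(members by completeness of `stdAcc`; non-members by its soundness and the uniqueness of the
output word of `M`). [cite: HomerSelman2011, Thm. 6.3 (proof)] -/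
theorem stdLp_cover {L : Language Bool} (hL : L ∈ Classes.P) : ∃ c : List Bool, stdLp c = L := by
  obtain ⟨p, M, hM⟩ := mem_P_iff_holds.1 hL
  obtain ⟨e, pM, hcomplete, hsound⟩ := stdAcc_spec M
  obtain ⟨k, hk⟩ := exists_eval_le_pow_add_two (pM.comp p)
  refine ⟨boolPair e (List.replicate k true), Set.ext fun z => ?_⟩
  show accInst (boolPair e (List.replicate k true)) z ∈ stdAcc ↔ z ∈ L
  rw [accInst_boolPair]
  have hz : M.OutputsWithin z [L.boolIndicator z] (p.eval z.length) := hM z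
  constructor
  · intro hacc
    obtain ⟨t, ht⟩ := hsound z _ hacc
    have heq : [true] = [L.boolIndicator z] := outputsWithin_unique M ht hz
    exact (Set.mem_iff_boolIndicator L z).2 (List.singleton_injective heq).symm
  · intro hzL
    rw [(Set.mem_iff_boolIndicator L z).1 hzL] at hz
    refine hcomplete z (p.eval z.length) _ hz ?_
    simpa [eval_comp] using hk z.length

/-- **`P` is effectively presentable** (Homer–Selman 2011, Thm. 6.3), in the form
`Ladner.IsPresentationOfP stdLp` consumed by `Ladner.ladner_of`.
[cite: HomerSelman2011, Thm. 6.3] -/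
theorem isPresentationOfP_stdLp : IsPresentationOfP stdLp :=
  ⟨stdLp_mem_P, fun _ hL => stdLp_cover hL⟩

end Ladner

end Literature.Computability.Complexity

end
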